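import Mathlib
import HarnessLib
import Summits.NavierStokesRegularity.NavierStokesRegularity.Theses.RootDecompPointVertex

/-!
# RootDecompPointVertex — glue `LeanTangentPointVertex_of_quietShell_gap` (stmt-NavierStokesRegularity-31113) PROVED

Route N12 `route-NavierStokesRegularity-RootDecompPointVertex` (decomp-ns lens-4 g8 «point vertex»; writer g4).
The crux ISO `LeanTangentPointVertex` (stmt-29913) was SPLIT (gen 1, lens-4 g9 «THE QUIET SHELL», critic row 89
CLEARED) into QSH `LeanTangentQuietShell` and GAP `QuietShellGap` with the glue item
`LeanTangentPointVertex_of_quietShell_gap : QSH → GAP → ISO` (stmt-31113, support, rank 303). The item's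
docstring gives the proof: «ε := min ε_GAP ε_QSH(δ₀): take δ₀, ε_GAP from GAP, ε_QSH from QSH at δ₀, weaken
(1+min)-leanness to each, apply QSH then GAP» (lens kernel `QuietShell.pointVertex_of_pieces`, axioms std; the
writer's Sketch `leanTangentPointVertex_of_quietShell_gap` was attached as evidence GlueProof.lean but never
landed). This file lands it against the route decl BY NAME. Pure logic over the born texts (leanness is
monotone in ε); no analysis. Navier–Stokes regularity is NOT proved by anything here (rung 0): QSH (residual,
IDEA-NEEDED) and GAP (stub_quietEnvelope open) stay open; the glue only certifies that closing both closes ISO.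
-/
noncomputable section

-- the summit and its single sub-problem share the name (CONVENTIONS §1), as in every Theorems file
set_option linter.dupNamespace false

open MeasureTheory Set Filter Topology
open scoped ENNReal

namespace Summit.NavierStokesRegularity.NavierStokesRegularity.Theorems.LeanTangentPointVertex

/-- Leanness is monotone in the level: `(1+ε')`-lean implies `(1+ε)`-lean for `ε' ≤ ε`. -/
theorem lean_mono {ε ε' : ℝ} {a b : ℝ≥0∞} (h : a ≤ ENNReal.ofReal (1 + ε') * b) (hle : ε' ≤ ε) :
    a ≤ ENNReal.ofReal (1 + ε) * b :=
  h.trans (mul_le_mul_of_nonneg_right (ENNReal.ofReal_le_ofReal (by linarith)) bot_le)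

/-- **Glue `LeanTangentPointVertex_of_quietShell_gap` (stmt-NavierStokesRegularity-31113) holds**:
QSH → GAP → ISO with `ε := min ε_GAP ε_QSH(δ₀)` — run QSH at GAP's level `δ₀` on the `(1+min)`-lean
threshold blow-up (leanness weakened to each of the two levels by `lean_mono`), then apply GAP.
(Lens `QuietShell.pointVertex_of_pieces`, verbatim over the born texts.) -/
theorem leanTangentPointVertex_of_quietShell_gap_proof :
    Theses.RootDecompPointVertex.LeanTangentPointVertex_of_quietShell_gap := by
  intro hQ hG
  obtain ⟨δ, hδ, ε₁, hε₁, hG⟩ := hG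
  obtain ⟨ε₂, hε₂, hQ⟩ := hQ δ hδ
  refine ⟨min ε₁ ε₂, lt_min hε₁ hε₂, fun ν T hν hT u p hmax hLH hdec hmarg hmin hTI hex => ?_⟩
  have hmin₁ := fun v hv hbad => lean_mono (hmin v hv hbad) (min_le_left ε₁ ε₂)
  have hmin₂ := fun v hv hbad => lean_mono (hmin v hv hbad) (min_le_right ε₁ ε₂)
  exact hG ν T hν hT u p hmax hLH hdec hmarg hmin₁ hTI
    (hQ ν T hν hT u p hmax hLH hdec hmarg hmin₂ hTI hex)

end Summit.NavierStokesRegularity.NavierStokesRegularity.Theorems.LeanTangentPointVertex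

end
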